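import Mathlib
import Summits.Ventures.DiscreteObjects.Mahler.MahlerMeasureIntegral

/-!
# The Mahler measure of an integer polynomial is a Perron number (venture `DiscreteObjects`, target L)

Cell `pub-namedobj`, seat `pub-namedobj-mahler` (gen 10). Framing: lottery ticket; floor = certified
bounds/negative ranges.

[McKee–Smyth, *Around the Unit Circle*, Exercise 1.10 (p. 8)]: "Show that the Mahler measure `M(P)` of an
integer polynomial `P` is a Perron number" — a real positive algebraic integer all of whose other
conjugates have modulus strictly less than itself.  Integrality is `isIntegral_intMahlerMeasure`
(Prop. 1.9, `MahlerMeasureIntegral`); here we prove the conjugate bound.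

Kernel route.  Over the splitting field `K` of `P` (a number field) with a fixed embedding
`φ₀ : K → ℂ`, put `β = a ∏_{α ∈ S} α` with `a = lc(P)` and `S` the roots `α` of `P` in `K` with
`|φ₀ α| > 1`; then `φ₀ β = a ∏_{|γ|>1} γ =: β_ℂ` is real with `|β_ℂ| = M(P)`.  Every conjugate of `β_ℂ`
is `τ β = a ∏_{α ∈ S} τ α` for an embedding `τ : K → ℂ` (Mathlib
`NumberField.Embeddings.range_eval_eq_rootSet_minpoly`), and `τ` maps the roots of `P` in `K` onto the
complex roots; so `|τ β| ≤ |a| ∏_{all γ} max(1, |γ|) = M(P)`, with equality only if the multiset `τ(S)`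
is exactly the multiset of roots outside the unit circle, i.e. only if `τ β = β_ℂ`
(`norm_mul_prod_lt_of_outside`, `exists_outside_of_ne_filter`).

* `norm_mul_prod_le_of_le` / `norm_mul_prod_lt_of_outside` / `exists_outside_of_ne_filter` — multiset
  inequalities behind "`|conjugate| < M` unless it is `M`";
* `isConjRoot_leadingCoeff_mul_prod_roots` — conjugates of `β_ℂ = lc(P) ∏_{|γ|>1} γ` are `β_ℂ` or of
  modulus `< M(P)`;
* `intMahlerMeasure_isPerron` — **every conjugate `γ ≠ M(P)` of `M(P)` over `ℚ` has `|γ| < M(P)`.**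
-/

namespace Summit.Ventures.DiscreteObjects.Mahler

open Polynomial
open scoped ComplexConjugate

/-! ### Multiset inequalities -/

/-- `1 ≤ ∏_{U} max(1, ‖γ‖)`. -/
theorem one_le_prod_map_max_one_norm (U : Multiset ℂ) : (1 : ℝ) ≤ (U.map fun γ => max 1 ‖γ‖).prod := by
  induction U using Multiset.induction_on with
  | empty => simp
  | cons γ U ih =>
    rw [Multiset.map_cons, Multiset.prod_cons]
    have h1 : (1 : ℝ) ≤ max 1 ‖γ‖ := le_max_left _ _
    nlinarith

/-- `‖∏ T‖ ≤ ∏_{T} max(1, ‖γ‖)`. -/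
theorem norm_prod_le_prod_map_max (T : Multiset ℂ) : ‖T.prod‖ ≤ (T.map fun γ => max 1 ‖γ‖).prod := by
  have h : ‖T.prod‖ = (T.map fun γ => ‖γ‖).prod := by
    rw [← normHom_apply, map_multiset_prod]; rfl
  rw [h]
  exact Multiset.prod_map_le_prod_map₀ _ _ (fun γ _ => norm_nonneg γ) (fun γ _ => le_max_right _ _)

/-- For `T ≤ R`: `‖a · ∏ T‖ ≤ ‖a‖ · ∏_{R} max(1, ‖γ‖)`. -/
theorem norm_mul_prod_le_of_le (a : ℂ) {T R : Multiset ℂ} (hTR : T ≤ R) :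
    ‖a * T.prod‖ ≤ ‖a‖ * (R.map fun γ => max 1 ‖γ‖).prod := by
  obtain ⟨U, rfl⟩ := Multiset.le_iff_exists_add.mp hTR
  rw [norm_mul, Multiset.map_add, Multiset.prod_add]
  refine mul_le_mul_of_nonneg_left ?_ (norm_nonneg a)
  have h1 := norm_prod_le_prod_map_max T
  have h2 := one_le_prod_map_max_one_norm U
  have h0 : 0 ≤ (T.map fun γ => max 1 ‖γ‖).prod := le_trans (norm_nonneg _) h1
  nlinarith

/-- Strict version: if `a ≠ 0` and the complement `U` (`R = T + U`) contains some `γ` with `‖γ‖ > 1`,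
then `‖a · ∏ T‖ < ‖a‖ · ∏_{R} max(1, ‖γ‖)`. -/
theorem norm_mul_prod_lt_of_outside {a : ℂ} (ha : a ≠ 0) (T U : Multiset ℂ) {γ : ℂ} (hγU : γ ∈ U)
    (hγ : ¬ ‖γ‖ ≤ 1) :
    ‖a * T.prod‖ < ‖a‖ * ((T + U).map fun γ => max 1 ‖γ‖).prod := by
  rw [norm_mul, Multiset.map_add, Multiset.prod_add]
  have ha' : 0 < ‖a‖ := norm_pos_iff.mpr ha
  have h1 := norm_prod_le_prod_map_max T
  have hT1 : (1 : ℝ) ≤ (T.map fun γ => max 1 ‖γ‖).prod := one_le_prod_map_max_one_norm T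
  -- `∏_U max(1,‖·‖) > 1`
  obtain ⟨U', rfl⟩ := Multiset.exists_cons_of_mem hγU
  rw [Multiset.map_cons, Multiset.prod_cons]
  have hγ' : (1 : ℝ) < max 1 ‖γ‖ := lt_max_of_lt_right (not_le.mp hγ)
  have hU' := one_le_prod_map_max_one_norm U'
  have h2 : (1 : ℝ) < max 1 ‖γ‖ * (U'.map fun γ => max 1 ‖γ‖).prod := by nlinarith
  calc ‖a‖ * ‖T.prod‖ ≤ ‖a‖ * (T.map fun γ => max 1 ‖γ‖).prod := mul_le_mul_of_nonneg_left h1 ha'.le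
    _ = ‖a‖ * (T.map fun γ => max 1 ‖γ‖).prod * 1 := (mul_one _).symm
    _ < ‖a‖ * (T.map fun γ => max 1 ‖γ‖).prod *
          (max 1 ‖γ‖ * (U'.map fun γ => max 1 ‖γ‖).prod) := by
        apply mul_lt_mul_of_pos_left h2
        positivity
    _ = ‖a‖ * ((T.map fun γ => max 1 ‖γ‖).prod *
          (max 1 ‖γ‖ * (U'.map fun γ => max 1 ‖γ‖).prod)) := by ring

/-- If `R = T + U`, `|T| = |{γ ∈ R : ‖γ‖ > 1}|` and `T` is not that sub-multiset, then `U` contains some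
`γ` with `‖γ‖ > 1`. -/
theorem exists_outside_of_ne_filter (T U : Multiset ℂ)
    (hcard : Multiset.card T = Multiset.card ((T + U).filter fun γ => ¬ ‖γ‖ ≤ 1))
    (hne : T ≠ (T + U).filter fun γ => ¬ ‖γ‖ ≤ 1) : ∃ γ ∈ U, ¬ ‖γ‖ ≤ 1 := by
  by_contra h
  push Not at h
  have hU : U.filter (fun γ => ¬ ‖γ‖ ≤ 1) = 0 :=
    Multiset.filter_eq_nil.mpr (fun γ hγ hn => hn (h γ hγ))
  rw [Multiset.filter_add, hU, add_zero] at hcard hne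
  have hle : T.filter (fun γ => ¬ ‖γ‖ ≤ 1) ≤ T := Multiset.filter_le _ T
  exact hne (Multiset.eq_of_le_of_card_le hle hcard.le).symm

/-! ### Conjugates -/

/-- **Conjugates of `β_ℂ = lc(P) · ∏_{|γ|>1} γ`.**  For `P ∈ ℤ[X]`, `P ≠ 0`, with complex roots `R`
(multiset) and `β_ℂ = lc(P) · ∏ (R.filter (|γ| > 1))`: every conjugate of `β_ℂ` over `ℚ` is `β_ℂ` itself
or has modulus `< M(P) = |β_ℂ|`. -/
theorem isConjRoot_leadingCoeff_mul_prod_roots {P : ℤ[X]} (hP : P ≠ 0) {γ : ℂ}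
    (hγ : IsConjRoot ℚ ((P.leadingCoeff : ℂ) *
      (((P.map (Int.castRingHom ℂ)).roots).filter fun a => ¬ ‖a‖ ≤ 1).prod) γ) :
    γ = (P.leadingCoeff : ℂ) * (((P.map (Int.castRingHom ℂ)).roots).filter fun a => ¬ ‖a‖ ≤ 1).prod ∨
      ‖γ‖ < intMahlerMeasure P := by
  classical
  -- splitting field, a fixed embedding `φ₀`, roots in `K`
  let PQ : ℚ[X] := P.map (Int.castRingHom ℚ)
  let K := PQ.SplittingField
  haveI : CharZero K := charZero_of_injective_algebraMap (algebraMap ℚ K).injective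
  haveI : NumberField K := NumberField.mk
  let φ₀ : K →ₐ[ℚ] ℂ := IsAlgClosed.lift
  have hmapK : P.map (algebraMap ℤ K) = PQ.map (algebraMap ℚ K) := by
    show P.map (algebraMap ℤ K) = (P.map (Int.castRingHom ℚ)).map (algebraMap ℚ K)
    rw [Polynomial.map_map]
    congr 1
  have hsplitK : (P.map (algebraMap ℤ K)).Splits := by
    rw [hmapK]
    exact SplittingField.splits PQ
  set RK := (P.map (algebraMap ℤ K)).roots with hRK
  set RC := (P.map (Int.castRingHom ℂ)).roots with hRC
  -- every embedding `τ : K →+* ℂ` maps the roots of `P` in `K` onto the complex roots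
  have hroots : ∀ τ : K →+* ℂ, RK.map τ = RC := by
    intro τ
    have hPC : P.map (Int.castRingHom ℂ) = (P.map (algebraMap ℤ K)).map τ := by
      rw [Polynomial.map_map]
      congr 1
      exact RingHom.ext_int _ _
    rw [hRC, hPC, hRK]
    exact roots_map_of_injective_of_card_eq_natDegree τ.injective (splits_iff_card_roots.mp hsplitK)
  -- `S` = roots whose `φ₀`-image lies outside the closed unit disc; `β = a · ∏ S`
  set S := RK.filter fun α => ¬ ‖φ₀ α‖ ≤ 1 with hS
  set aK : K := algebraMap ℤ K P.leadingCoeff with haK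
  set β : K := aK * S.prod with hβ
  set SC := RC.filter fun a => ¬ ‖a‖ ≤ 1 with hSC
  have hSφ : S.map φ₀ = SC := by
    rw [hSC, ← hroots φ₀.toRingHom, hS]
    rw [AlgHom.toRingHom_eq_coe, RingHom.coe_coe, Multiset.filter_map]
    rfl
  have haφ : ∀ τ : K →+* ℂ, τ aK = (P.leadingCoeff : ℂ) := by
    intro τ
    rw [haK]
    simp
  have hβφ : φ₀ β = (P.leadingCoeff : ℂ) * SC.prod := by
    rw [hβ, map_mul, map_multiset_prod, hSφ, ← haφ φ₀.toRingHom]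
    rfl
  -- the conjugate `γ` is `τ β` for some embedding `τ`
  have hmin : minpoly ℚ (φ₀ β) = minpoly ℚ β := minpoly.algHom_eq φ₀ φ₀.injective β
  have hγroot : γ ∈ (minpoly ℚ β).rootSet ℂ := by
    rw [← hmin, hβφ]
    have hint : IsIntegral ℚ ((P.leadingCoeff : ℂ) * SC.prod) := by
      rw [← hβφ]
      exact (Algebra.IsIntegral.isIntegral (R := ℚ) β).map φ₀
    exact (isConjRoot_iff_mem_minpoly_rootSet hint).mp hγ
  rw [← NumberField.Embeddings.range_eval_eq_rootSet_minpoly K ℂ β] at hγroot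
  obtain ⟨τ, hτ⟩ := hγroot
  -- `τ β = a · ∏ τ(S)` with `τ(S) ≤` complex roots, `|τ(S)| = |SC|`
  have hτβ : τ β = (P.leadingCoeff : ℂ) * (S.map τ).prod := by
    rw [hβ, map_mul, map_multiset_prod, haφ τ]
  have hle : S.map τ ≤ RC := by
    rw [← hroots τ]
    exact Multiset.map_le_map (Multiset.filter_le _ _)
  obtain ⟨U, hU⟩ := Multiset.le_iff_exists_add.mp hle
  have hcardS : Multiset.card (S.map τ) = Multiset.card SC := by
    rw [Multiset.card_map, ← hSφ, Multiset.card_map]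
  have ha0 : (P.leadingCoeff : ℂ) ≠ 0 := by exact_mod_cast leadingCoeff_ne_zero.mpr hP
  have hM : intMahlerMeasure P = ‖(P.leadingCoeff : ℂ)‖ * (RC.map fun γ => max 1 ‖γ‖).prod := by
    unfold intMahlerMeasure
    rw [mahlerMeasure_eq_leadingCoeff_mul_prod_roots,
      leadingCoeff_map_of_injective (Int.castRingHom ℂ).injective_int, eq_intCast]
  rw [← hτ]
  change τ β = _ ∨ ‖τ β‖ < _
  by_cases heq : S.map τ = SC
  · left
    rw [hτβ, heq]
  · right
    rw [hτβ, hM, hU]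
    rw [hU] at hSC
    have hne : S.map τ ≠ (S.map τ + U).filter fun γ => ¬ ‖γ‖ ≤ 1 := by rwa [← hSC]
    have hcard' : Multiset.card (S.map τ) =
        Multiset.card ((S.map τ + U).filter fun γ => ¬ ‖γ‖ ≤ 1) := by rw [← hSC]; exact hcardS
    obtain ⟨γ', hγ'U, hγ'⟩ := exists_outside_of_ne_filter _ _ hcard' hne
    exact norm_mul_prod_lt_of_outside ha0 _ _ hγ'U hγ'

/-- **[McKee–Smyth, Exercise 1.10]: `M(P)` is a Perron number.**  For every `P ∈ ℤ[X]`, every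
conjugate `γ ∈ ℂ` of `M(P)` over `ℚ` (a root of the minimal polynomial of `M(P)`) is `M(P)` itself or
satisfies `|γ| < M(P)`.  With `isIntegral_intMahlerMeasure` (`M(P)` is an algebraic integer) and
`M(P) ≥ 1 > 0` for `P ≠ 0`, this says that `M(P)` is a Perron number. -/
theorem intMahlerMeasure_isPerron (P : ℤ[X]) {γ : ℂ}
    (hγ : IsConjRoot ℚ ((intMahlerMeasure P : ℝ) : ℂ) γ) :
    γ = ((intMahlerMeasure P : ℝ) : ℂ) ∨ ‖γ‖ < intMahlerMeasure P := by
  classical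
  by_cases hP : P = 0
  · left
    have hM0 : intMahlerMeasure P = 0 := by
      unfold intMahlerMeasure; rw [hP, Polynomial.map_zero, mahlerMeasure_zero]
    rw [hM0, Complex.ofReal_zero] at hγ ⊢
    have h := hγ.aeval_eq_zero
    rwa [minpoly.zero, aeval_X] at h
  set SC := ((P.map (Int.castRingHom ℂ)).roots).filter fun a => ¬ ‖a‖ ≤ 1 with hSC
  set βC : ℂ := (P.leadingCoeff : ℂ) * SC.prod with hβC
  -- `β_ℂ` is real and `M(P) = |β_ℂ|`, so `M(P) = ± β_ℂ`
  have hβconj : conj βC = βC := by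
    rw [hβC, map_mul, conj_prod_roots_outside P, map_intCast]
  have hβreal : ((βC.re : ℝ) : ℂ) = βC := Complex.conj_eq_iff_re.mp hβconj
  have hMabs : intMahlerMeasure P = |βC.re| := by
    rw [intMahlerMeasure_eq_norm_leadingCoeff_mul_prod_roots, ← hSC, ← hβC]
    conv_lhs => rw [← hβreal]
    rw [Complex.norm_real, Real.norm_eq_abs]
  rcases abs_choice βC.re with h | h
  · -- `M = β_ℂ`
    have hMC : ((intMahlerMeasure P : ℝ) : ℂ) = βC := by rw [hMabs, h, hβreal]
    rw [hMC] at hγ ⊢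
    rcases isConjRoot_leadingCoeff_mul_prod_roots hP hγ with h1 | h1
    · exact Or.inl h1
    · exact Or.inr h1
  · -- `M = -β_ℂ`: conjugates of `-β_ℂ` are negatives of conjugates of `β_ℂ`
    have hMC : ((intMahlerMeasure P : ℝ) : ℂ) = -βC := by
      rw [hMabs, h, Complex.ofReal_neg, hβreal]
    rw [hMC] at hγ ⊢
    have hγ' : IsConjRoot ℚ βC (-γ) := by
      have := hγ.neg
      rwa [neg_neg] at this
    rcases isConjRoot_leadingCoeff_mul_prod_roots hP hγ' with h1 | h1
    · left
      have h1' : -γ = βC := by rw [hβC, hSC]; exact h1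
      rw [← h1', neg_neg]
    · right
      rwa [norm_neg] at h1

end Summit.Ventures.DiscreteObjects.Mahler
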